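import Summits.ResolutionOfSingularities.ResolutionOfSingularities.Theorems.EquisingularLiftEquisingularLiftNatModelStep
import Literature.AlgebraicGeometry.Resolution.BlowupChartMembership
import Literature.AlgebraicGeometry.Resolution.BlowupStalkCharts
import Literature.AlgebraicGeometry.Resolution.AffineBlowupUnique
import Literature.AlgebraicGeometry.Resolution.AlterationsSectionDivisor
import Literature.AlgebraicGeometry.Resolution.StalkIdealLemmas
import Literature.AlgebraicGeometry.Resolution.MarkedIdealsArithmetic
import Mathlib.RingTheory.Flat.TorsionFree
import Mathlib.AlgebraicGeometry.Morphisms.Flat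
import HarnessLib

/-!
# [OURS · L1 W4.5(b) · EL♮(3)] `E ⊆ closure (E ∖ Z)` — THE DENSITY STAND-IN `hEZ` of res-D-pv-029's `Tower.inv₂_coneRound_old`
# (…NatTowerConeRoundOld p560701) DISCHARGED from the cone-round data ALONE: (e-i)/(k-ii) exact traces, (k-iii) flatness of `V(𝓔 ⊔ 𝒦)`
# over `O`, (k-vi) «the cone cuts an effective Cartier divisor on `V(𝓔)`» — no ruled-surface datum needed

Crux chain w45b (cell `res-hironaka`, slot W4.5(b)), working crux **EL♮** = stmt-ResolutionOfSingularities-20038, child **EL♮(3)** =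
stmt-ResolutionOfSingularities-20148, route EquisingularLift, line `sections`; registered stub `stub_elnat_coneTowerPointResolution` @ `ReachTower₂`
(CHILD v19 4b326de54e94ad4b), clause (round), cone-witnessed disjunct, transported old surface. Written by res-L1-w45b-stub-2 g7 (res-L1-w45b-plan-1
NAMING 2026-08-27T19:11:35Z item (iii)). HONEST FRAMING: OURS; NOT a statement of any manuscript; AI-written, weaker than expert review. No `sorry`;
standard axioms; DEF-FREE. `--supports stmt-ResolutionOfSingularities-20148 --as helper`.

WHAT. `subset_closure_diff_of_flat_of_isEffectiveCartier`: in the binders of res-D-pv-029's cone round — the model square `jG : G ⟶ X` over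
`Spec θ` (`θ : O → k` onto, `O` a DVR), ideal sheaves `𝓔`, `𝒦` on the locally Noetherian `X` with exact reduced traces `𝓔·𝒪_G = 𝓘⟨E⟩` and
`(𝓔 ⊔ 𝒦)·𝒪_G = 𝓘⟨Z⟩`, `V(𝓔 ⊔ 𝒦) → Spec O` flat and `𝒦|_{V(𝓔)}` an effective Cartier divisor — **`E ⊆ closure (E ∖ Z)`**. So the stand-in
`hEZ` is NOT part of the ruled-surface datum: it is forced by (k-iii) + (k-vi).

PROOF (stalk-local; Matsumura §16 flavour). At `e ∈ E ∩ Z`, `x = jG e`, `A = 𝒪_{X,x}`: in `B = 𝒪_{V(𝓔),xe} = A/𝓔_x` the Cartier generator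
`d` of `𝒦·𝒪_{V(𝓔)}` is a nonzerodivisor; flatness of `A/(𝓔_x + 𝒦_x) = B/(d)` over `O` makes the uniformiser `ϖ` a nonzerodivisor modulo `d`;
hence (`exists_isPrime_mem_not_mem_of_regular_pair`: `dⁿ ∈ (ϖ)` would force `1 ∈ (ϖ)` by descending induction) some prime `𝔮 ∋ ϖ` of `B`
misses `d`. Its point `x' = Spec 𝒪_{X,x} → X` generalises `x`, lies in `V(𝓔)` and over the closed point of `O` (so `x' = jG e'`), but not in
`V(𝓔 ⊔ 𝒦)`: `e' ∈ E ∖ Z` and `e' ⤳ e`.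

References (index only): res-D-pv-029 …NatTowerConeRoundOld p560701 (the consumer), …NatTowerInvDefs (`Tower.Shadow₂` (k-iii)/(k-vi));
Literature `IsEffectiveCartier.exists_stalkIdeal_eq_span`, `comap_fromSpecStalk_eq_affineBlowupIdealSheaf`, `affineBlowup.support_idealSheaf`,
`stalkIdeal_ker_eq_ker_stalkMap`; Mathlib `Module.Flat.isSMulRegular_of_nonZeroDivisors`, `Scheme.range_fromSpecStalk`.
[cite: Matsumura1987, §16] (regular sequences; index only).
-/

set_option linter.dupNamespace false -- mandated namespace `Summit.<Summit>.<Problem>` of this single-conjunct summit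
set_option linter.overlappingInstances false -- the binders carry `[IsDomain O] [IsDiscreteValuationRing O]`

noncomputable section

open CategoryTheory CategoryTheory.Limits AlgebraicGeometry TopologicalSpace Topology IsLocalRing
open Literature.AlgebraicGeometry.Resolution
open AlgebraicGeometry.Scheme.IdealSheafData

namespace Summit.ResolutionOfSingularities.ResolutionOfSingularities.Cruxes.EquisingularLiftNat.Sections

universe u

/-! ## The ring lemma -/

/-- **A regular pair `(d, ϖ)` with `ϖ` a non-unit: some prime contains `ϖ` but not `d`.** If `d` is a nonzerodivisor, `ϖ` is a
nonzerodivisor modulo `d` and `ϖ` is not a unit, then `d ∉ √(ϖ)` — otherwise `dⁿ = ϖu` descends to `1 ∈ (ϖ)`. [cite: Matsumura1987, §16]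
[folklore] -/
theorem exists_isPrime_mem_not_mem_of_regular_pair {B : Type u} [CommRing B] {d ϖ : B} (hd : d ∈ nonZeroDivisors B)
    (hϖd : ∀ y : B, ϖ * y ∈ Ideal.span {d} → y ∈ Ideal.span {d}) (hϖ : ¬ IsUnit ϖ) :
    ∃ 𝔮 : Ideal B, 𝔮.IsPrime ∧ ϖ ∈ 𝔮 ∧ d ∉ 𝔮 := by
  by_contra hcon
  push Not at hcon
  have hrad : d ∈ (Ideal.span {ϖ} : Ideal B).radical := by
    rw [Ideal.radical_eq_sInf, Submodule.mem_sInf]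
    rintro 𝔮 ⟨hϖ𝔮, h𝔮⟩
    exact hcon 𝔮 h𝔮 (hϖ𝔮 (Ideal.mem_span_singleton_self ϖ))
  obtain ⟨n, hn⟩ := hrad
  have key : ∀ m : ℕ, d ^ m ∈ Ideal.span {ϖ} → (1 : B) ∈ Ideal.span {ϖ} := by
    intro m
    induction m with
    | zero => intro h; simpa only [pow_zero] using h
    | succ m ih =>
      intro h
      obtain ⟨u, hu⟩ := Ideal.mem_span_singleton'.mp h
      -- `ϖ u = d^(m+1) ∈ (d)`, so `u ∈ (d)`, `u = u₁ d`
      have hu' : ϖ * u ∈ Ideal.span {d} :=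
        Ideal.mem_span_singleton'.mpr ⟨d ^ m, by rw [mul_comm ϖ u, hu, pow_succ]⟩
      obtain ⟨u₁, hu₁⟩ := Ideal.mem_span_singleton'.mp (hϖd u hu')
      -- cancel `d`: `d^m = u₁ ϖ`
      have hdm : d ^ m = u₁ * ϖ := by
        have h1 : (d ^ m - u₁ * ϖ) * d = 0 := by
          rw [sub_mul, ← pow_succ, ← hu, ← hu₁]; ring
        exact sub_eq_zero.mp ((mem_nonZeroDivisors_iff_right.mp hd) _ h1)
      exact ih (Ideal.mem_span_singleton'.mpr ⟨u₁, hdm.symm⟩)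
  exact hϖ (Ideal.span_singleton_eq_top.mp ((Ideal.eq_top_iff_one _).mpr (key n hn)))

/-! ## The stalk-local step -/

section Local

variable {O : Type u} [CommRing O] [IsDomain O] [IsDiscreteValuationRing O]
  {X : Scheme.{u}} (r : X ⟶ Spec (.of O)) (𝓔 𝒦 : X.IdealSheafData)

set_option maxHeartbeats 400000 in
/-- **The stalk-local step.** At a point `ŵ` of `V(𝓔 ⊔ 𝒦)` over the closed point of `O`, with `V(𝓔 ⊔ 𝒦) → Spec O` flat and `𝒦|_{V(𝓔)}`
effective Cartier: some generalisation `x'` of the point in `X` lies in `V(𝓔)`, over the closed point of `O`, and NOT in `V(𝓔 ⊔ 𝒦)`.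
[cite: Matsumura1987, §16] [OURS · L1 W4.5b] -/
theorem exists_specializes_mem_support_not_mem [IsLocallyNoetherian X]
    (hflat : Flat ((𝓔 ⊔ 𝒦).subschemeι ≫ r)) (hK𝓔 : IsEffectiveCartier (𝒦.comap 𝓔.subschemeι))
    (ŵ : ↥(𝓔 ⊔ 𝒦).subscheme) (hŵ : r ((𝓔 ⊔ 𝒦).subschemeι ŵ) = closedPoint O) :
    ∃ x' : X, x' ⤳ (𝓔 ⊔ 𝒦).subschemeι ŵ ∧ x' ∈ 𝓔.support ∧ x' ∉ (𝓔 ⊔ 𝒦).support ∧ r x' = closedPoint O := by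
  classical
  -- the point of `V(𝓔)` under `ŵ`, and the base point `x`
  set incl := Scheme.IdealSheafData.inclusion (le_sup_left : 𝓔 ≤ 𝓔 ⊔ 𝒦) with hincl
  have hfac : incl ≫ 𝓔.subschemeι = (𝓔 ⊔ 𝒦).subschemeι := Scheme.IdealSheafData.inclusion_subschemeι _
  set xe : ↥𝓔.subscheme := incl ŵ with hxe
  have hxw : 𝓔.subschemeι xe = (𝓔 ⊔ 𝒦).subschemeι ŵ := by
    rw [hxe, ← Scheme.Hom.comp_apply, hfac]
  rw [← hxw] at hŵ ⊢
  set x : X := 𝓔.subschemeι xe with hx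
  -- the rings: `A = 𝒪_{X,x}`, `B = 𝒪_{V(𝓔),xe}` with `φ : A ↠ B`, kernel `𝓔_x`
  set A := X.presheaf.stalk x
  set φ := (𝓔.subschemeι.stalkMap xe).hom with hφ
  have hφsurj : Function.Surjective φ := 𝓔.subschemeι.stalkMap_surjective xe
  have hφker : RingHom.ker φ = stalkIdeal 𝓔 x := by
    rw [hφ, ← stalkIdeal_ker_eq_ker_stalkMap, Scheme.IdealSheafData.ker_subschemeι]
  -- `ψ : A ↠ C = 𝒪_{V(𝓔 ⊔ 𝒦),ŵ}` (the stalk map of the closed immersion `incl ≫ ι`), kernel `𝓔_x + 𝒦_x`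
  haveI : IsClosedImmersion (incl ≫ 𝓔.subschemeι) := by rw [hfac]; infer_instance
  set ψ : (A : Type u) →+* ((𝓔 ⊔ 𝒦).subscheme.presheaf.stalk ŵ : Type u) := ((incl ≫ 𝓔.subschemeι).stalkMap ŵ).hom with hψ
  have hkerJ : (incl ≫ 𝓔.subschemeι).ker = 𝓔 ⊔ 𝒦 := by rw [hfac, Scheme.IdealSheafData.ker_subschemeι]
  have hψker : RingHom.ker ψ = stalkIdeal 𝓔 x ⊔ stalkIdeal 𝒦 x := by
    have h1 := stalkIdeal_ker_eq_ker_stalkMap (incl ≫ 𝓔.subschemeι) ŵ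
    rw [hkerJ, stalkIdeal_sup] at h1
    exact h1.symm
  -- the Cartier generator `d ∈ B` of `𝒦·𝒪_{V(𝓔)}` at `xe`
  obtain ⟨d, hd, hKd⟩ := hK𝓔.exists_stalkIdeal_eq_span xe
  have hKd' : (stalkIdeal 𝒦 x).map φ = Ideal.span {d} := by
    rw [← hKd, hφ, stalkIdeal_comap_eq_map_stalkMap]
  -- the uniformiser `ϖ`, its germ `ϖs` at `r x`, its image `ϖA ∈ A`
  obtain ⟨ϖ, hϖ⟩ := IsDiscreteValuationRing.exists_irreducible O
  have hϖmax : maximalIdeal O = Ideal.span {ϖ} := hϖ.maximalIdeal_eq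
  have hϖ0 : ϖ ≠ 0 := hϖ.ne_zero
  set ϖΓ : Γ(Spec (.of O), ⊤) := (Scheme.ΓSpecIso (.of O)).inv ϖ with hϖΓ
  set ϖs : (Spec (.of O)).presheaf.stalk (r x) := (Spec (CommRingCat.of O)).presheaf.germ ⊤ (r x) trivial ϖΓ with hϖs
  set ϖA : A := (r.stalkMap x).hom ϖs with hϖA
  -- the ideal sheaf of the closed point of `O`, pulled back to `X`: support = special fibre, stalk at `x` = `(ϖA)`
  set 𝓜₀ : (Spec (.of O)).IdealSheafData := affineBlowup.idealSheaf (maximalIdeal O) with h𝓜₀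
  set 𝓜 : X.IdealSheafData := 𝓜₀.comap r with h𝓜
  have h𝓜supp : ∀ y : X, y ∈ 𝓜.support ↔ r y = closedPoint O := by
    intro y
    rw [h𝓜, Scheme.IdealSheafData.support_comap]
    change r y ∈ (𝓜₀.support : Set (Spec (.of O))) ↔ _
    rw [h𝓜₀, affineBlowup.support_idealSheaf]
    change ((maximalIdeal O : Set O) ⊆ ((r y).asIdeal : Set O)) ↔ _
    rw [SetLike.coe_subset_coe]
    constructor
    · intro h
      apply PrimeSpectrum.ext
      exact ((IsLocalRing.maximalIdeal.isMaximal O).eq_of_le (r y).2.ne_top h).symm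
    · intro h; rw [h]; rfl
  have h𝓜₀stalk : stalkIdeal 𝓜₀ (r x) = Ideal.span {ϖs} := by
    rw [stalkIdeal_eq_map_germ 𝓜₀ ⟨⊤, isAffineOpen_top _⟩ trivial, h𝓜₀, affineBlowup.idealSheaf, ideal_ofIdealTop_top,
      Ideal.map_map, hϖmax, Ideal.map_span, Set.image_singleton]
    rfl
  have h𝓜stalk : stalkIdeal 𝓜 x = Ideal.span {ϖA} := by
    rw [h𝓜, stalkIdeal_comap_eq_map_stalkMap, h𝓜₀stalk, Ideal.map_span, Set.image_singleton]
  -- points of `Spec A → X`: membership in `V(𝓔)`, `V(𝓔 ⊔ 𝒦)`, the special fibre, read on primes of `A`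
  let f := X.fromSpecStalk x
  have hfmem : ∀ (J : X.IdealSheafData) (𝔭 : PrimeSpectrum A), f 𝔭 ∈ J.support ↔ stalkIdeal J x ≤ 𝔭.asIdeal := by
    intro J 𝔭
    have h1 : f 𝔭 ∈ J.support ↔ 𝔭 ∈ ((J.comap f).support : Set (Spec A)) := by
      rw [Scheme.IdealSheafData.support_comap]; rfl
    rw [h1, comap_fromSpecStalk_eq_affineBlowupIdealSheaf, affineBlowup.support_idealSheaf]
    change ((stalkIdeal J x : Set A) ⊆ (𝔭.asIdeal : Set A)) ↔ _
    rw [SetLike.coe_subset_coe]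
  -- (0) `ϖA ∈ 𝔪_A` (as `x` lies over the closed point), so `φ ϖA` is not a unit
  have hϖA_mem : ϖA ∈ maximalIdeal A := by
    have h1 : f (closedPoint A) ∈ 𝓜.support := by
      rw [h𝓜supp]
      change r (X.fromSpecStalk x (closedPoint (X.presheaf.stalk x))) = closedPoint O
      rw [Scheme.fromSpecStalk_closedPoint]; exact hŵ
    rw [hfmem, h𝓜stalk, Ideal.span_singleton_le_iff_mem] at h1
    exact h1
  have hϖB_nu : ¬ IsUnit (φ ϖA) := fun h =>
    (IsLocalRing.mem_maximalIdeal _ |>.mp hϖA_mem) (isUnit_of_map_unit φ ϖA h)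
  -- (1) `ϖs` is a nonzerodivisor of the stalk of `Spec O` (a localisation of the domain `O`)
  have hϖs_reg : ϖs ∈ nonZeroDivisors ((Spec (.of O)).presheaf.stalk (r x)) := by
    letI : Algebra Γ(Spec (.of O), ⊤) ((Spec (CommRingCat.of O)).presheaf.stalk (r x)) :=
      ((Spec (CommRingCat.of O)).presheaf.germ ⊤ (r x) trivial).hom.toAlgebra
    haveI := (isAffineOpen_top (Spec (.of O))).isLocalization_stalk ⟨r x, trivial⟩
    have hϖΓreg : ϖΓ ∈ nonZeroDivisors Γ(Spec (.of O), ⊤) := by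
      refine mem_nonZeroDivisors_of_ne_zero ?_
      rw [hϖΓ]
      intro h0
      apply hϖ0
      have := congrArg (Scheme.ΓSpecIso (.of O)).hom h0
      simpa using this
    exact map_mem_nonZeroDivisors_of_isLocalization
      (((isAffineOpen_top (Spec (.of O))).primeIdealOf ⟨r x, trivial⟩).asIdeal.primeCompl) _ hϖΓreg
  -- (2) flatness: `ψ ϖA` is a nonzerodivisor of `C`
  have hflat' : Flat ((incl ≫ 𝓔.subschemeι) ≫ r) := by rw [hfac]; exact hflat
  have hψϖ : ψ ϖA ∈ nonZeroDivisors ((𝓔 ⊔ 𝒦).subscheme.presheaf.stalk ŵ) := by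
    haveI := hflat'
    have hfl := Flat.stalkMap ((incl ≫ 𝓔.subschemeι) ≫ r) ŵ
    have hcomp : (((incl ≫ 𝓔.subschemeι) ≫ r).stalkMap ŵ).hom ϖs = ψ ϖA := by
      rw [Scheme.Hom.stalkMap_comp]
      rfl
    set g : ((Spec (.of O)).presheaf.stalk (r x) : Type u) →+* ((𝓔 ⊔ 𝒦).subscheme.presheaf.stalk ŵ : Type u) :=
      (((incl ≫ 𝓔.subschemeι) ≫ r).stalkMap ŵ).hom with hg
    have hgfl : g.Flat := hfl
    letI : Algebra ((Spec (.of O)).presheaf.stalk (r x) : Type u) ((𝓔 ⊔ 𝒦).subscheme.presheaf.stalk ŵ : Type u) := g.toAlgebra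
    haveI : Module.Flat ((Spec (.of O)).presheaf.stalk (r x) : Type u) ((𝓔 ⊔ 𝒦).subscheme.presheaf.stalk ŵ : Type u) := hgfl
    have hsm := Module.Flat.isSMulRegular_of_nonZeroDivisors (M := ((𝓔 ⊔ 𝒦).subscheme.presheaf.stalk ŵ : Type u)) hϖs_reg
    rw [← hcomp]
    refine mem_nonZeroDivisors_iff_right.mpr fun y hy => ?_
    apply hsm
    change ϖs • y = ϖs • (0 : ((𝓔 ⊔ 𝒦).subscheme.presheaf.stalk ŵ : Type u))
    rw [smul_zero, Algebra.smul_def, RingHom.algebraMap_toAlgebra, mul_comm]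
    exact hy
  -- (3) in `A`: `ϖA` is a nonzerodivisor modulo `𝓔_x + 𝒦_x`
  have hϖA_reg : ∀ a : A, ϖA * a ∈ stalkIdeal 𝓔 x ⊔ stalkIdeal 𝒦 x → a ∈ stalkIdeal 𝓔 x ⊔ stalkIdeal 𝒦 x := by
    intro a ha
    rw [← hψker] at ha ⊢
    have h1 : ψ (ϖA * a) = 0 := ha
    rw [map_mul, mul_comm] at h1
    exact (mem_nonZeroDivisors_iff_right.mp hψϖ) _ h1
  -- (4) in `B`: `φ ϖA` is a nonzerodivisor modulo `d`
  have hcomapK : Ideal.comap φ (Ideal.map φ (stalkIdeal 𝒦 x)) = stalkIdeal 𝓔 x ⊔ stalkIdeal 𝒦 x := by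
    rw [Ideal.comap_map_of_surjective _ hφsurj, ← RingHom.ker_eq_comap_bot, hφker, sup_comm]
  have hϖB : ∀ y, φ ϖA * y ∈ Ideal.span {d} → y ∈ Ideal.span {d} := by
    intro y hy
    obtain ⟨a, rfl⟩ := hφsurj y
    rw [← map_mul, ← hKd', ← Ideal.mem_comap, hcomapK] at hy
    have ha := hϖA_reg a hy
    rw [← hcomapK, Ideal.mem_comap] at ha
    rw [← hKd']; exact ha
  -- (5) the prime of `B`, pulled back to `A`
  obtain ⟨𝔮, h𝔮, hϖ𝔮, hd𝔮⟩ := exists_isPrime_mem_not_mem_of_regular_pair hd hϖB hϖB_nu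
  set 𝔭 : Ideal A := 𝔮.comap φ with h𝔭
  haveI h𝔭p : 𝔭.IsPrime := Ideal.IsPrime.comap φ
  have h𝔭E : stalkIdeal 𝓔 x ≤ 𝔭 := by
    rw [← hφker, h𝔭]
    intro a ha
    rw [Ideal.mem_comap, RingHom.mem_ker.mp ha]; exact zero_mem _
  have h𝔭ϖ : ϖA ∈ 𝔭 := hϖ𝔮
  have h𝔭K : ¬ stalkIdeal 𝒦 x ≤ 𝔭 := by
    intro hle
    apply hd𝔮
    have : Ideal.span {d} ≤ 𝔮 := by rw [← hKd', Ideal.map_le_iff_le_comap]; exact hle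
    exact this (Ideal.mem_span_singleton_self d)
  -- (6) the point `x' = f 𝔭`
  refine ⟨f ⟨𝔭, h𝔭p⟩, ?_, ?_, ?_, ?_⟩
  · have : f ⟨𝔭, h𝔭p⟩ ∈ Set.range f := ⟨_, rfl⟩
    rw [Scheme.range_fromSpecStalk] at this
    exact this
  · exact (hfmem 𝓔 ⟨𝔭, h𝔭p⟩).mpr h𝔭E
  · intro hmem
    rw [hfmem, stalkIdeal_sup] at hmem
    exact h𝔭K (le_trans le_sup_right hmem)
  · rw [← h𝓜supp, hfmem, h𝓜stalk, Ideal.span_singleton_le_iff_mem]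
    exact h𝔭ϖ

end Local

/-! ## The downstairs density -/

/-- **`E ⊆ closure (E ∖ Z)` from the cone-round data** (res-D-pv-029's stand-in `hEZ` of `Tower.inv₂_coneRound_old`, DISCHARGED): in the
model square `jG : G ⟶ X` over `Spec θ` (`θ : O ↠ k`, `O` a DVR, `X` locally Noetherian), for ideal sheaves `𝓔`, `𝒦` with exact reduced traces
`𝓔·𝒪_G = 𝓘⟨E⟩`, `(𝓔 ⊔ 𝒦)·𝒪_G = 𝓘⟨Z⟩`, `V(𝓔 ⊔ 𝒦) → Spec O` flat ((k-iii)) and `𝒦|_{V(𝓔)}` effective Cartier ((k-vi)), every point of `E`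
is a specialisation of a point of `E ∖ Z`. [cite: Matsumura1987, §16] [OURS · L1 W4.5b] toward `stub_elnat_coneTowerPointResolution`
(stmt-ResolutionOfSingularities-20148 / -20038); NOT a statement of the manuscript. -/
theorem subset_closure_diff_of_flat_of_isEffectiveCartier {O : Type u} [CommRing O] [IsDomain O] [IsDiscreteValuationRing O]
    {k : Type u} [Field k] (θ : O →+* k) (hθ : Function.Surjective θ)
    {P : Scheme.{u}} (q : P ⟶ Spec (.of O)) {G X : Scheme.{u}} [IsLocallyNoetherian X]
    (σ : X ⟶ P) (jG : G ⟶ X) (tG : G ⟶ Spec (.of k)) (hsq : IsPullback jG tG (σ ≫ q) (Spec.map (CommRingCat.ofHom θ)))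
    (𝓔 𝒦 : X.IdealSheafData) {E Z : Set G} (hE : IsClosed E) (hZ : IsClosed Z)
    (hEi : 𝓔.comap jG = vanishingIdeal ⟨E, hE⟩) (hZi : (𝓔 ⊔ 𝒦).comap jG = vanishingIdeal ⟨Z, hZ⟩)
    (hflat : Flat ((𝓔 ⊔ 𝒦).subschemeι ≫ σ ≫ q)) (hK𝓔 : IsEffectiveCartier (𝒦.comap 𝓔.subschemeι)) :
    E ⊆ closure (E \ Z) := by
  classical
  intro e he
  by_cases heZ : e ∈ Z
  swap
  · exact subset_closure ⟨he, heZ⟩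
  -- the special fibre is the range of `jG`, a closed immersion
  haveI : IsClosedImmersion (Spec.map (CommRingCat.ofHom θ)) := IsClosedImmersion.spec_of_surjective _ hθ
  haveI : IsClosedImmersion jG := MorphismProperty.IsStableUnderBaseChange.of_isPullback hsq.flip inferInstance
  have hrange : Set.range jG = (σ ≫ q) ⁻¹' {closedPoint O} := by
    rw [range_eq_preimage_of_isPullback hsq, range_specMap_of_surjective_of_field θ hθ]
  have hEsupp : ∀ g : G, g ∈ E ↔ jG g ∈ 𝓔.support := fun g => by
    have h : g ∈ ((𝓔.comap jG).support : Set G) ↔ jG g ∈ 𝓔.support := by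
      rw [Scheme.IdealSheafData.support_comap]; rfl
    rw [← h, hEi, Scheme.IdealSheafData.coe_support_vanishingIdeal]; rfl
  have hZsupp : ∀ g : G, g ∈ Z ↔ jG g ∈ (𝓔 ⊔ 𝒦).support := fun g => by
    have h : g ∈ (((𝓔 ⊔ 𝒦).comap jG).support : Set G) ↔ jG g ∈ (𝓔 ⊔ 𝒦).support := by
      rw [Scheme.IdealSheafData.support_comap]; rfl
    rw [← h, hZi, Scheme.IdealSheafData.coe_support_vanishingIdeal]; rfl
  -- the point `ŵ` of `V(𝓔 ⊔ 𝒦)` over `jG e`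
  have hx : jG e ∈ Set.range (𝓔 ⊔ 𝒦).subschemeι := by
    rw [Scheme.IdealSheafData.range_subschemeι]; exact (hZsupp e).mp heZ
  obtain ⟨ŵ, hŵ⟩ := hx
  have hspec : (σ ≫ q) ((𝓔 ⊔ 𝒦).subschemeι ŵ) = closedPoint O := by
    have h : jG e ∈ Set.range jG := ⟨e, rfl⟩
    rw [hrange] at h
    rw [hŵ]; exact h
  obtain ⟨x', hx'e, hx'E, hx'Z, hx's⟩ :=
    exists_specializes_mem_support_not_mem (σ ≫ q) 𝓔 𝒦 hflat hK𝓔 ŵ hspec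
  -- `x' = jG e'` with `e' ∈ E ∖ Z`, `e' ⤳ e`
  have hx'r : x' ∈ Set.range jG := by rw [hrange]; exact hx's
  obtain ⟨e', rfl⟩ := hx'r
  have he'E : e' ∈ E := (hEsupp e').mpr hx'E
  have he'Z : e' ∉ Z := fun h => hx'Z ((hZsupp e').mp h)
  have he'e : e' ⤳ e := by
    rw [← jG.isClosedEmbedding.isInducing.specializes_iff, ← hŵ] ; exact hx'e
  have hsub : ({e'} : Set G) ⊆ E \ Z := Set.singleton_subset_iff.mpr ⟨he'E, he'Z⟩
  exact closure_mono hsub (specializes_iff_mem_closure.mp he'e)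


end Summit.ResolutionOfSingularities.ResolutionOfSingularities.Cruxes.EquisingularLiftNat.Sections

end
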